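import Mathlib
import HarnessLib
import Literature.Computability.AlgebraicComplexity.CohnUmansTPP
import Literature.Computability.AlgebraicComplexity.GroupAlgebraTensor
import Literature.Computability.AlgebraicComplexity.GroupAlgebraRankBounds

/-!
# TPP screens at a finite far edge (lens-2 «structural dichotomy», gen 66, Kernel L part 1):
# strict packing and Neumann's abelian-index bound, formalised

Route-independent support module (def-free, sorry-free; no `Theses` import) for the special crux
`FiniteSaturation` (stmt-MatrixMultiplication-23739, `∃ k ≥ 2, ω(1,k,1) = k + 1`) of the route
`FarEdgeDescent`; the cut of record `closes (h₁ : FiniteSaturation) (h₂ : AnchoredLogConvexity)` is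
UNCHANGED and nothing here enters it.  Companion file `FarEdgeDescentTPPSaturation` (part 2) turns
these screens into the sufficient condition «TPP saturation ⟹ h₁» and its exact kill criterion.

The mechanism screened is the Cohn–Umans TRIPLE PRODUCT PROPERTY (a combinatorial RESTRICTION
`⟨n,m,p⟩ ≤ ℂ[G]` through subsets `S, T, U ⊆ G`; Cohn–Umans 2003 Def. 2.1 / Thm. 2.3; tree
`RealizesTPP`) aimed at the far tensor `⟨a, a^k, a⟩` within the budget `a^{(k+1)(1+ε)}`.

* §0 bookkeeping `|G| ≤ R(ℂ[G]) ≤ ∑_χ χ(1)³ ≤ d_max(G)·|G|` (★ `card_le_tensorRank_groupTensor`,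
  ★ `tensorRank_groupTensor_le_charDegreePowSum_three`,
  ★ `charDegreePowSum_three_le_maxCharDegree_mul_card`; HHMM 2013 Thm. 3.1 and §1.4).
* §2 the typed SCREENS every witness `(G, S, T, U)` must pass:
  ★ `tpp_mul_lt_card` — **strict packing**: if `G` realizes `⟨n, m, p⟩` with `p ≥ 2` then
  `n·m < |G|` (were `(s,t) ↦ s⁻¹t` onto, `Q(S)Q(T) = G` would meet `Q(U)`; compare Neumann's
  `|T|(|S|+|U|-1) ≤ |G|`, HHMM Lemma 1.11); hence ★ `pow_succ_lt_tensorRank_of_tpp`: a group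
  realizing `⟨a, a^k, a⟩`, `a ≥ 2`, has `a^{k+1} < |G| ≤ R(ℂ[G])` — NO SINGLE GROUP IS
  FORMAT-TIGHT, so (unlike a host: one tensor and its powers) a TPP-saturating family is an
  infinite family of groups with packing defect `log|G|/log(a^{k+1}) - 1 → 0`;
  ★ `tpp_of_subset_translate` (independent right translation of the three sets preserves the TPP,
  Neumann Obs. 2.1 / HHMM Lemma 1.9); ★★ `tpp_mul_mul_le_index_sq_mul_card` — **abelian-section
  screen** = P. M. Neumann's index bound (Neumann 2011 Obs. 4.1 / Cor. 4.2: `β(G) ≤ v²|G|`),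
  formalised: if `G` realizes `⟨n, m, p⟩` and `B ≤ G` is an abelian subgroup of index `h` then
  `n·m·p ≤ h²·|G|` (pigeonhole one right coset of `B` carrying `≥ 1/h` of each of `S, T, U`;
  translate each part into `B`; Cohn–Umans Lemma 3.1 inside `B`); so for `⟨a, a^k, a⟩` within
  budget every abelian subgroup has index `h ≥ a^{(1-(k+1)ε)/2}` (★ `index_sq_ge_of_tpp_budget`),
  in particular ★ `not_tpp_budget_of_comm`: abelian groups — exactly the unit-tensor hosts of
  Kernel XLIX-C (`FarEdgeDescentHostUnit`) — are excluded for every `ε < 1/(k+1)`; the TPP is what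
  keeps them out.  Neumann (p. 237) notes his bound is asymptotically attained (`ρ(G) → v²` on
  powers of the CKSU groups `A ≀ C₂`) and «tells us nothing» for `ω = 2`, where `d_max ≈ |G|^{1/2}`
  is forced; at a FINITE far edge the budget keeps all degrees small and the bound bites.
Nothing here proves `ω = 2` or the crux; no definitions (gate rule D-0009).

[cite: CohnUmans2003, Def. 2.1, Thm. 2.3, Lemma 3.1]
[cite: HartEtAl2013, §1.4, Lemma 1.9, Lemma 1.11, Thm. 3.1] [cite: Pospelov2011, Thm. 7]
[cite: Neumann2011, Obs. 2.1, Obs. 4.1, Cor. 4.2]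
[cite: BurgisserClausenShokrollahi1997, (15.19)–(15.20)]
Written by the decomp-mm lens-2 planner seat (gen 66); imports only BUILT modules.
-/

namespace Summit.MatrixMultiplication.MatrixMultiplication.Theorems.FarEdgeDescentTPPScreens

open Literature.Computability.AlgebraicComplexity
open Literature.RepresentationTheory.FiniteGroups

/-! ## §0 Group-algebra rank bookkeeping: `|G| ≤ R(ℂ[G]) ≤ ∑ᵢ dᵢ³ ≤ d_max · |G|` -/

/-- `|G| ≤ R(ℂ[G])` (from `2|G| ≤ R(G) + k(G)`, HHMM Thm. 3.1 / Alder–Strassen, and `k(G) ≤ |G|`).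
[cite: HartEtAl2013, Thm. 3.1] -/
theorem card_le_tensorRank_groupTensor (G : Type) [Group G] [Fintype G] [DecidableEq G] :
    Fintype.card G ≤ tensorRank (groupTensor ℂ G) := by
  have h := HartEtAl2013_thm31_lower (G := G)
  have hcl : Nat.card (ConjClasses G) ≤ Fintype.card G := by
    rw [← Nat.card_eq_fintype_card]
    exact Nat.card_le_card_of_surjective _ (ConjClasses.mk_surjective (α := G))
  omega

/-- `R(ℂ[G]) ≤ ∑_χ χ(1)^3` — Wedderburn: `R(G) ≤ ∑ᵢ R(⟨dᵢ,dᵢ,dᵢ⟩)` (HHMM §1.4) and the standard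
algorithm `R(⟨d,d,d⟩) ≤ d³`. [cite: HartEtAl2013, §1.4] -/
theorem tensorRank_groupTensor_le_charDegreePowSum_three (G : Type) [Group G] [Fintype G]
    [DecidableEq G] : (tensorRank (groupTensor ℂ G) : ℝ) ≤ charDegreePowSum G 3 := by
  obtain ⟨r, d, hd, ⟨φ⟩⟩ := exists_algEquiv_pi_matrix G
  haveI : ∀ i, NeZero (d i) := hd
  rw [HartEtAl2013.charDegreePowSum_eq_sum_blockDegrees_rpow φ]
  have h1 := HartEtAl2013_rank_le_sum_blocks φ
  have h2 : ∑ i, tensorRank (matMulTensor ℂ (d i) (d i) (d i)) ≤ ∑ i, d i * d i * d i :=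
    Finset.sum_le_sum fun i _ => tensorRank_matMulTensor_le ℂ (d i) (d i) (d i)
  calc (tensorRank (groupTensor ℂ G) : ℝ) ≤ ((∑ i, d i * d i * d i : ℕ) : ℝ) := by
        exact_mod_cast h1.trans h2
    _ = ∑ i, (d i : ℝ) ^ (3 : ℝ) := by
        push_cast
        refine Finset.sum_congr rfl fun i _ => ?_
        rw [show (3 : ℝ) = ((3 : ℕ) : ℝ) by norm_num, Real.rpow_natCast]
        ring

/-- `∑_χ χ(1)^3 ≤ d_max(G) · |G|` (`dᵢ ≤ d_max`, `∑ dᵢ² = |G|`; the step from Thm. 1.8 to Cor. 1.9 of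
CKSU 2005 at `ω = 3`). [cite: CohnKleinbergSzegedyUmans2005, Cor. 1.9] -/
theorem charDegreePowSum_three_le_maxCharDegree_mul_card (G : Type) [Group G] [Fintype G]
    [DecidableEq G] : charDegreePowSum G 3 ≤ (maxCharDegree G : ℝ) * Fintype.card G := by
  obtain ⟨r, d, hd, ⟨φ⟩⟩ := exists_algEquiv_pi_matrix G
  haveI : ∀ i, NeZero (d i) := hd
  rw [HartEtAl2013.charDegreePowSum_eq_sum_blockDegrees_rpow φ]
  have hsq := sum_sq_blockDegrees_eq_card φ
  rw [Nat.card_eq_fintype_card] at hsq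
  calc ∑ i, (d i : ℝ) ^ (3 : ℝ) = ∑ i, (d i : ℝ) * (d i : ℝ) ^ 2 := by
        refine Finset.sum_congr rfl fun i _ => ?_
        rw [show (3 : ℝ) = ((3 : ℕ) : ℝ) by norm_num, Real.rpow_natCast]
        ring
    _ ≤ ∑ i, (maxCharDegree G : ℝ) * (d i : ℝ) ^ 2 :=
        Finset.sum_le_sum fun i _ => mul_le_mul_of_nonneg_right
          (by exact_mod_cast blockDegree_le_maxCharDegree φ i) (sq_nonneg _)
    _ = (maxCharDegree G : ℝ) * ((∑ i, d i ^ 2 : ℕ) : ℝ) := by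
        rw [← Finset.mul_sum]; push_cast; rfl
    _ = (maxCharDegree G : ℝ) * Fintype.card G := by rw [hsq]

/-! ## §2 Screens: strict packing, abelian sections -/

/-- ★ **Strict packing.**  If `G` realizes `⟨n, m, p⟩` with `p ≥ 2`, then `n·m < |G|`: the map
`(s,t) ↦ s⁻¹t` is injective on `S × T` (Cohn–Umans, proof of Lemma 3.1) and NOT onto — for
`u ≠ u'` in `U`, `s₀ ∈ S`, `t₀ ∈ T` the element `s₀⁻¹ (u'u⁻¹) t₀` is not of the form `s'⁻¹t`, else
`s₀s'⁻¹ · t t₀⁻¹ · u u'⁻¹ = 1` violates the TPP. [cite: CohnUmans2003, Lemma 3.1 (proof)] -/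
theorem tpp_mul_lt_card {G : Type} [Group G] [Fintype G] [DecidableEq G] {n m p : ℕ}
    (h : RealizesTPP G n m p) (hp : 2 ≤ p) : n * m < Fintype.card G := by
  classical
  obtain ⟨S, T, U, hS, hT, hU, hTPP⟩ := h
  rcases S.eq_empty_or_nonempty with hSe | ⟨s₀, hs₀⟩
  · subst hSe; simp only [Finset.card_empty] at hS; subst hS; simpa using Fintype.card_pos
  rcases T.eq_empty_or_nonempty with hTe | ⟨t₀, ht₀⟩
  · subst hTe; simp only [Finset.card_empty] at hT; subst hT; simpa using Fintype.card_pos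
  obtain ⟨u, hu, u', hu', huu⟩ : ∃ u ∈ U, ∃ u' ∈ U, u ≠ u' := Finset.one_lt_card.mp (by omega)
  have hinj : Set.InjOn (fun x : G × G => x.1⁻¹ * x.2) ↑(S ×ˢ T) := by
    rintro ⟨s, t⟩ hst ⟨s', t'⟩ hst' (he : s⁻¹ * t = s'⁻¹ * t')
    simp only [Finset.coe_product, Set.mem_prod, Finset.mem_coe] at hst hst'
    have key : s' * s⁻¹ * (t * t'⁻¹) * (u * u⁻¹) = 1 := by
      rw [mul_inv_cancel, mul_one, mul_assoc, ← mul_assoc s⁻¹, he]; group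
    obtain ⟨h1, h2, -⟩ := hTPP s' hst'.1 s hst.1 t hst.2 t' hst'.2 u hu u hu key
    exact Prod.ext h1.symm h2
  -- the missing element
  set g : G := s₀⁻¹ * (u' * u⁻¹) * t₀ with hg
  have hmiss : g ∉ (S ×ˢ T).image fun x : G × G => x.1⁻¹ * x.2 := by
    intro hmem
    obtain ⟨⟨s', t⟩, hst, he⟩ := Finset.mem_image.mp hmem
    simp only [Finset.mem_product] at hst
    have key : s₀ * s'⁻¹ * (t * t₀⁻¹) * (u * u'⁻¹) = 1 := by
      have he' : s'⁻¹ * t = s₀⁻¹ * (u' * u⁻¹) * t₀ := he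
      calc s₀ * s'⁻¹ * (t * t₀⁻¹) * (u * u'⁻¹) = s₀ * (s'⁻¹ * t) * t₀⁻¹ * (u * u'⁻¹) := by group
        _ = 1 := by rw [he']; group
    obtain ⟨-, -, h3⟩ := hTPP s₀ hs₀ s' hst.1 t hst.2 t₀ ht₀ u hu u' hu' key
    exact huu h3
  have hsub : ((S ×ˢ T).image fun x : G × G => x.1⁻¹ * x.2) ⊆ Finset.univ.erase g := by
    intro x hx
    exact Finset.mem_erase.mpr ⟨fun hxg => hmiss (hxg ▸ hx), Finset.mem_univ _⟩
  calc n * m = (S ×ˢ T).card := by rw [Finset.card_product, hS, hT]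
    _ = ((S ×ˢ T).image fun x : G × G => x.1⁻¹ * x.2).card := (Finset.card_image_of_injOn hinj).symm
    _ ≤ (Finset.univ.erase g).card := Finset.card_le_card hsub
    _ < Fintype.card G := by
        rw [Finset.card_erase_of_mem (Finset.mem_univ g), Finset.card_univ]
        exact Nat.sub_lt Fintype.card_pos Nat.one_pos

/-- ★ **No single group is format-tight at the far edge**: a group realizing `⟨a, a^k, a⟩` with
`a ≥ 2` has `a^{k+1} < |G| ≤ R(ℂ[G])`.  (So the fixed-tensor «host» version of TPP saturation —
one group algebra and its tensor powers `ℂ[G]^{⊗N} = ℂ[G^N]`, which realize `⟨a^N, a^{kN}, a^N⟩` —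
has cost exponent `≥ log|G| / log a > k + 1`, bounded away from `k + 1`: the saturating family of §1
must vary the group with the tolerance.) [cite: CohnUmans2003, Lemma 3.1 (proof)]
[cite: HartEtAl2013, Thm. 3.1] -/
theorem pow_succ_lt_tensorRank_of_tpp {G : Type} [Group G] [Fintype G] [DecidableEq G] {a k : ℕ}
    (ha : 2 ≤ a) (h : RealizesTPP G a (a ^ k) a) :
    a ^ (k + 1) < Fintype.card G ∧ Fintype.card G ≤ tensorRank (groupTensor ℂ G) := by
  refine ⟨?_, card_le_tensorRank_groupTensor G⟩
  have h1 := tpp_mul_lt_card h ha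
  calc a ^ (k + 1) = a * a ^ k := by ring
    _ < Fintype.card G := h1

/-- The TPP is inherited by subsets of right translates `S' ⊆ S·a`, `T' ⊆ T·b`, `U' ⊆ U·c`
(each set translated separately: `(xa)(x'a)⁻¹ = x x'⁻¹`). [cite: CohnUmans2003, Def. 2.1] -/
theorem tpp_of_subset_translate {G : Type} [Group G] [DecidableEq G] {S T U : Finset G}
    (hTPP : ∀ s ∈ S, ∀ s' ∈ S, ∀ t ∈ T, ∀ t' ∈ T, ∀ u ∈ U, ∀ u' ∈ U,
      s * s'⁻¹ * (t * t'⁻¹) * (u * u'⁻¹) = 1 → s = s' ∧ t = t' ∧ u = u')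
    (a b c : G) {S' T' U' : Finset G} (hS : S' ⊆ S.image (· * a)) (hT : T' ⊆ T.image (· * b))
    (hU : U' ⊆ U.image (· * c)) :
    ∀ s ∈ S', ∀ s' ∈ S', ∀ t ∈ T', ∀ t' ∈ T', ∀ u ∈ U', ∀ u' ∈ U',
      s * s'⁻¹ * (t * t'⁻¹) * (u * u'⁻¹) = 1 → s = s' ∧ t = t' ∧ u = u' := by
  intro s hs s' hs' t ht t' ht' u hu u' hu' he
  obtain ⟨x, hx, rfl⟩ := Finset.mem_image.mp (hS hs)
  obtain ⟨x', hx', rfl⟩ := Finset.mem_image.mp (hS hs')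
  obtain ⟨y, hy, rfl⟩ := Finset.mem_image.mp (hT ht)
  obtain ⟨y', hy', rfl⟩ := Finset.mem_image.mp (hT ht')
  obtain ⟨z, hz, rfl⟩ := Finset.mem_image.mp (hU hu)
  obtain ⟨z', hz', rfl⟩ := Finset.mem_image.mp (hU hu')
  have he' : x * x'⁻¹ * (y * y'⁻¹) * (z * z'⁻¹) = 1 := by
    rw [← he]; group
  obtain ⟨h1, h2, h3⟩ := hTPP x hx x' hx' y hy y' hy' z hz z' hz' he'
  exact ⟨by rw [h1], by rw [h2], by rw [h3]⟩

/-- Pigeonhole over the right cosets of a subgroup `B`: a finite set `S ⊆ G` has a part `F` of size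
`≥ |S| / [G:B]` inside one right coset, i.e. with `s s'⁻¹ ∈ B` on `F`. [folklore] -/
theorem exists_sub_coset_part {G : Type} [Group G] [Fintype G] [DecidableEq G] (B : Subgroup G)
    (S : Finset G) :
    ∃ F : Finset G, F ⊆ S ∧ S.card ≤ B.index * F.card ∧ ∀ s ∈ F, ∀ s' ∈ F, s * s'⁻¹ ∈ B := by
  classical
  let π : G → G ⧸ B := fun s => ((s⁻¹ : G) : G ⧸ B)
  have hsum : S.card = ∑ y : G ⧸ B, (S.filter fun x => π x = y).card :=
    Finset.card_eq_sum_card_fiberwise fun x _ => Finset.mem_univ (π x)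
  have hidx : B.index = Fintype.card (G ⧸ B) := by
    rw [Subgroup.index_eq_card, Nat.card_eq_fintype_card]
  have hex : ∃ y : G ⧸ B, S.card ≤ B.index * (S.filter fun x => π x = y).card := by
    by_contra hcon
    push Not at hcon
    have hlt : ∑ y : G ⧸ B, B.index * (S.filter fun x => π x = y).card <
        ∑ _y : G ⧸ B, S.card :=
      Finset.sum_lt_sum_of_nonempty Finset.univ_nonempty fun y _ => hcon y
    rw [← Finset.mul_sum, ← hsum, Finset.sum_const, Finset.card_univ, smul_eq_mul, ← hidx] at hlt
    exact lt_irrefl _ hlt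
  obtain ⟨y, hy⟩ := hex
  refine ⟨S.filter fun x => π x = y, Finset.filter_subset _ _, hy, ?_⟩
  intro s hs s' hs'
  rw [Finset.mem_filter] at hs hs'
  have hss : π s = π s' := hs.2.trans hs'.2.symm
  have hmem := QuotientGroup.eq.mp hss
  simpa using hmem

/-- In a group, if `x, x', y, y', z, z'` pairwise commute (they lie in an abelian subgroup) and
`x y z = x' y' z'`, then the TPP quotient product is trivial. [cite: CohnUmans2003, Lemma 3.1] -/
theorem quotient_prod_eq_one_of_comm {G : Type} [Group G] (B : Subgroup G)
    (hB : ∀ a ∈ B, ∀ b ∈ B, a * b = b * a) {x x' y y' z z' : G} (_hx : x ∈ B) (hx' : x' ∈ B)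
    (hy : y ∈ B) (hy' : y' ∈ B) (hz : z ∈ B) (hz' : z' ∈ B) (he : x * y * z = x' * y' * z') :
    x * x'⁻¹ * (y * y'⁻¹) * (z * z'⁻¹) = 1 := by
  have c1 : x'⁻¹ * y = y * x'⁻¹ := hB _ (B.inv_mem hx') _ hy
  have c2 : x'⁻¹ * y'⁻¹ * z = z * (x'⁻¹ * y'⁻¹) :=
    hB _ (B.mul_mem (B.inv_mem hx') (B.inv_mem hy')) _ hz
  have c3 : z' * y' = y' * z' := hB _ hz' _ hy'
  have c4 : y' * z' * x' = x' * (y' * z') := hB _ (B.mul_mem hy' hz') _ hx'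
  calc x * x'⁻¹ * (y * y'⁻¹) * (z * z'⁻¹) = x * (x'⁻¹ * y) * y'⁻¹ * z * z'⁻¹ := by group
    _ = x * (y * x'⁻¹) * y'⁻¹ * z * z'⁻¹ := by rw [c1]
    _ = x * y * (x'⁻¹ * y'⁻¹ * z) * z'⁻¹ := by group
    _ = x * y * (z * (x'⁻¹ * y'⁻¹)) * z'⁻¹ := by rw [c2]
    _ = (x * y * z) * (z' * y' * x')⁻¹ := by group
    _ = (x * y * z) * (x' * (y' * z'))⁻¹ := by rw [c3, c4]
    _ = 1 := by rw [he]; group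

/-- ★★ **Abelian-section screen** (P. M. Neumann's index bound, Observation 4.1 / Corollary 4.2
of Neumann 2011: `β(G) ≤ v²|G|` for an abelian subgroup of index `v`; formalised here).  If `G`
realizes `⟨n, m, p⟩` through the TPP and `B ≤ G` is an ABELIAN subgroup of index `h`, then
`n·m·p ≤ h²·|G|`: inside one right coset of `B` lie `≥ n/h` elements of `S` (resp. `≥ m/h` of `T`,
`≥ p/h` of `U`); translating each part into `B` preserves the TPP, and Cohn–Umans Lemma 3.1 in the
abelian group `B` gives `(n/h)(m/h)(p/h) ≤ |B| = |G|/h`.  (For `h = 1` this is Lemma 3.1 itself,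
tree `RealizesTPP.mul_mul_le_card`.  Neumann, p. 237, notes the bound is asymptotically attained —
`ρ(G) → v²` on direct powers of the CKSU groups `A ≀ C₂` — and that it «tells us nothing» for
`ω = 2`, where `d_max ≈ |G|^{1/2}` is forced; at a FINITE far edge the budget keeps the degrees
small and the bound bites, see `index_sq_ge_of_tpp_budget` and §3.)
[cite: Neumann2011, Obs. 4.1, Cor. 4.2] [cite: CohnUmans2003, Lemma 3.1] -/
theorem tpp_mul_mul_le_index_sq_mul_card {G : Type} [Group G] [Fintype G] [DecidableEq G]
    {n m p : ℕ} (h : RealizesTPP G n m p) (B : Subgroup G)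
    (hB : ∀ a ∈ B, ∀ b ∈ B, a * b = b * a) :
    n * m * p ≤ B.index ^ 2 * Fintype.card G := by
  classical
  obtain ⟨S, T, U, hS, hT, hU, hTPP⟩ := h
  obtain ⟨S₁, hS₁S, hS₁c, hS₁B⟩ := exists_sub_coset_part B S
  obtain ⟨T₁, hT₁T, hT₁c, hT₁B⟩ := exists_sub_coset_part B T
  obtain ⟨U₁, hU₁U, hU₁c, hU₁B⟩ := exists_sub_coset_part B U
  -- empty parts: then `n`, `m` or `p` is `0`
  rcases S₁.eq_empty_or_nonempty with hSe | ⟨s₀, hs₀⟩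
  · rw [hSe, Finset.card_empty, mul_zero, Nat.le_zero, hS] at hS₁c; simp [hS₁c]
  rcases T₁.eq_empty_or_nonempty with hTe | ⟨t₀, ht₀⟩
  · rw [hTe, Finset.card_empty, mul_zero, Nat.le_zero, hT] at hT₁c; simp [hT₁c]
  rcases U₁.eq_empty_or_nonempty with hUe | ⟨u₀, hu₀⟩
  · rw [hUe, Finset.card_empty, mul_zero, Nat.le_zero, hU] at hU₁c; simp [hU₁c]
  -- translate the three parts into `B`
  set S₂ : Finset G := S₁.image (· * s₀⁻¹) with hS₂
  set T₂ : Finset G := T₁.image (· * t₀⁻¹) with hT₂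
  set U₂ : Finset G := U₁.image (· * u₀⁻¹) with hU₂
  have hS₂c : S₂.card = S₁.card := Finset.card_image_of_injective _ (mul_left_injective _)
  have hT₂c : T₂.card = T₁.card := Finset.card_image_of_injective _ (mul_left_injective _)
  have hU₂c : U₂.card = U₁.card := Finset.card_image_of_injective _ (mul_left_injective _)
  have hS₂B : ∀ x ∈ S₂, x ∈ B := by
    intro x hx
    obtain ⟨s, hs, rfl⟩ := Finset.mem_image.mp hx
    exact hS₁B s hs s₀ hs₀
  have hT₂B : ∀ x ∈ T₂, x ∈ B := by
    intro x hx
    obtain ⟨t, ht, rfl⟩ := Finset.mem_image.mp hx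
    exact hT₁B t ht t₀ ht₀
  have hU₂B : ∀ x ∈ U₂, x ∈ B := by
    intro x hx
    obtain ⟨u, hu, rfl⟩ := Finset.mem_image.mp hx
    exact hU₁B u hu u₀ hu₀
  have hTPP₂ := tpp_of_subset_translate hTPP s₀⁻¹ t₀⁻¹ u₀⁻¹
    (S' := S₂) (T' := T₂) (U' := U₂)
    (Finset.image_subset_image hS₁S) (Finset.image_subset_image hT₁T) (Finset.image_subset_image hU₁U)
  -- Lemma 3.1 inside `B`: `(x, y, z) ↦ x y z` is injective on `S₂ × T₂ × U₂`, with image in `B`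
  have hinj : Set.InjOn (fun x : G × G × G => x.1 * x.2.1 * x.2.2) ↑(S₂ ×ˢ T₂ ×ˢ U₂) := by
    rintro ⟨x, y, z⟩ hx ⟨x', y', z'⟩ hx' (he : x * y * z = x' * y' * z')
    simp only [Finset.coe_product, Set.mem_prod, Finset.mem_coe] at hx hx'
    have key := quotient_prod_eq_one_of_comm B hB (hS₂B x hx.1) (hS₂B x' hx'.1) (hT₂B y hx.2.1)
      (hT₂B y' hx'.2.1) (hU₂B z hx.2.2) (hU₂B z' hx'.2.2) he
    obtain ⟨h1, h2, h3⟩ := hTPP₂ x hx.1 x' hx'.1 y hx.2.1 y' hx'.2.1 z hx.2.2 z' hx'.2.2 key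
    simp [h1, h2, h3]
  have himg : ((S₂ ×ˢ T₂ ×ˢ U₂).image fun x : G × G × G => x.1 * x.2.1 * x.2.2) ⊆
      Finset.univ.filter (· ∈ B) := by
    intro g hg
    obtain ⟨⟨x, y, z⟩, hxyz, rfl⟩ := Finset.mem_image.mp hg
    simp only [Finset.mem_product] at hxyz
    exact Finset.mem_filter.mpr ⟨Finset.mem_univ _,
      B.mul_mem (B.mul_mem (hS₂B x hxyz.1) (hT₂B y hxyz.2.1)) (hU₂B z hxyz.2.2)⟩
  have hBcard : (Finset.univ.filter (· ∈ B)).card = Nat.card B := by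
    rw [Nat.card_eq_fintype_card, Fintype.card_subtype]
  have hprod : S₁.card * T₁.card * U₁.card ≤ Nat.card B := by
    calc S₁.card * T₁.card * U₁.card = (S₂ ×ˢ T₂ ×ˢ U₂).card := by
          rw [Finset.card_product, Finset.card_product, hS₂c, hT₂c, hU₂c, mul_assoc]
      _ = ((S₂ ×ˢ T₂ ×ˢ U₂).image fun x : G × G × G => x.1 * x.2.1 * x.2.2).card :=
          (Finset.card_image_of_injOn hinj).symm
      _ ≤ (Finset.univ.filter (· ∈ B)).card := Finset.card_le_card himg
      _ = Nat.card B := hBcard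
  have hGB : Nat.card B * B.index = Fintype.card G := by
    rw [B.card_mul_index, Nat.card_eq_fintype_card]
  -- assemble: `n m p ≤ h³ |S₁||T₁||U₁| ≤ h³ |B| = h² |G|`
  rw [← hS, ← hT, ← hU]
  calc S.card * T.card * U.card
      ≤ (B.index * S₁.card) * (B.index * T₁.card) * (B.index * U₁.card) :=
        Nat.mul_le_mul (Nat.mul_le_mul hS₁c hT₁c) hU₁c
    _ = B.index ^ 2 * ((S₁.card * T₁.card * U₁.card) * B.index) := by ring
    _ ≤ B.index ^ 2 * (Nat.card B * B.index) :=
        Nat.mul_le_mul_left _ (Nat.mul_le_mul_right _ hprod)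
    _ = B.index ^ 2 * Fintype.card G := by rw [hGB]

/-- ★ **Abelian-section screen at the far edge, against the budget**: if `G` realizes `⟨a, a^k, a⟩`
and `B ≤ G` is abelian of index `h`, then `a^{k+2} ≤ h² |G|`; so a witness of TPP saturation at
tolerance `ε` (`|G| ≤ R(ℂ[G]) ≤ a^{(k+1)(1+ε)}`) has all abelian subgroups of index
`h ≥ a^{(1 − (k+1)ε)/2}` — near-abelian groups (bounded-index abelian subgroup) are excluded for
every `ε < 1/(k+1)`. [cite: CohnUmans2003, Lemma 3.1] -/
theorem index_sq_ge_of_tpp_budget {G : Type} [Group G] [Fintype G] [DecidableEq G] {a k : ℕ}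
    (h : RealizesTPP G a (a ^ k) a) (B : Subgroup G) (hB : ∀ x ∈ B, ∀ y ∈ B, x * y = y * x)
    {ε : ℝ} (hR : (tensorRank (groupTensor ℂ G) : ℝ) ≤ (a : ℝ) ^ (((k : ℝ) + 1) * (1 + ε))) :
    ((a : ℝ) ^ (k + 2)) ≤ (B.index : ℝ) ^ 2 * (a : ℝ) ^ (((k : ℝ) + 1) * (1 + ε)) := by
  have h1 : a * a ^ k * a ≤ B.index ^ 2 * Fintype.card G :=
    tpp_mul_mul_le_index_sq_mul_card h B hB
  have h2 : (Fintype.card G : ℝ) ≤ (a : ℝ) ^ (((k : ℝ) + 1) * (1 + ε)) :=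
    le_trans (by exact_mod_cast card_le_tensorRank_groupTensor G) hR
  have h1' : a ^ (k + 2) ≤ B.index ^ 2 * Fintype.card G := by
    calc a ^ (k + 2) = a * a ^ k * a := by ring
      _ ≤ _ := h1
  have h3 : ((a : ℝ) ^ (k + 2)) ≤ (B.index : ℝ) ^ 2 * Fintype.card G := by exact_mod_cast h1'
  exact h3.trans (mul_le_mul_of_nonneg_left h2 (by positivity))

/-- ★ **Abelian groups are excluded** (the unit-tensor hosts of Kernel XLIX-C are exactly what the
TPP keeps out): an abelian group realizing `⟨a, a^k, a⟩`, `a ≥ 2`, has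
`R(ℂ[G]) = |G| ≥ a^{k+2} > a^{(k+1)(1+ε)}` for every `ε < 1/(k+1)`.
[cite: CohnUmans2003, Lemma 3.1] [cite: HartEtAl2013, Thm. 3.1] -/
theorem not_tpp_budget_of_comm {G : Type} [CommGroup G] [Fintype G] [DecidableEq G] {a k : ℕ}
    (ha : 2 ≤ a) (h : RealizesTPP G a (a ^ k) a) {ε : ℝ} (hε : ε < 1 / ((k : ℝ) + 1)) :
    (a : ℝ) ^ (((k : ℝ) + 1) * (1 + ε)) < tensorRank (groupTensor ℂ G) := by
  have hcard : a * a ^ k * a ≤ Fintype.card G := h.mul_mul_le_card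
  have ha1 : (1 : ℝ) < a := by exact_mod_cast ha
  have hk : (0 : ℝ) < (k : ℝ) + 1 := by positivity
  have hε' : ((k : ℝ) + 1) * ε < 1 := by
    have := (lt_div_iff₀ hk).mp hε
    linarith
  calc (a : ℝ) ^ (((k : ℝ) + 1) * (1 + ε)) < (a : ℝ) ^ (((k + 2 : ℕ) : ℝ)) := by
        apply Real.rpow_lt_rpow_of_exponent_lt ha1
        push_cast
        nlinarith
    _ = ((a ^ (k + 2) : ℕ) : ℝ) := by rw [Real.rpow_natCast]; norm_cast
    _ ≤ Fintype.card G := by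
        have hcard' : a ^ (k + 2) ≤ Fintype.card G := by
          calc a ^ (k + 2) = a * a ^ k * a := by ring
            _ ≤ _ := hcard
        exact_mod_cast hcard'
    _ ≤ tensorRank (groupTensor ℂ G) := by exact_mod_cast card_le_tensorRank_groupTensor G

end Summit.MatrixMultiplication.MatrixMultiplication.Theorems.FarEdgeDescentTPPScreens
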